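import Literature.Geometry.Riemannian.CutLocusDimension
import Literature.Analysis.Convexity.ComplexTransport
import HarnessLib

/-!
# Buchner's triangulation theorem: independence of the Euclidean carrier of the complex

Topic `Geometry/Riemannian`; seventh support file of the programme towards the named fact
`Literature.Geometry.Riemannian.buchner1977_cutLocus_triangulable` of `CutLocus.lean`
(M. A. Buchner, *Simplicial structure of the real analytic cut locus*, Proc. AMS 64 (1977)
118–121: the cut locus of a point of a compact real-analytic Riemannian manifold is homeomorphic
to a finite simplicial complex). The fact realises the complex as a Mathlib
`Geometry.SimplicialComplex ℝ (EuclideanSpace ℝ (Fin N))`; triangulation theorems in the tree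
(e.g. the semialgebraic one, `Literature.ModelTheory.ExponentialFields.OhmotoShiota2017_c1Triangulation`)
and in print (Hironaka 1975, subanalytic triangulation in `ℝⁿ`) produce complexes in `Fin n → ℝ`
or in an arbitrary finite-dimensional real vector space. This file removes the dependence on the
carrier:

* `exists_simplicialComplex_equiv_image` — transport of a geometric simplicial complex along a
  continuous linear equivalence `e : V ≃L[ℝ] W` (through the tree's simplexwise-affine transport
  `Literature.Analysis.Convexity.exists_simplicialComplex_image`): faces `s.image e`, polyhedron
  `e '' |K|`;
* `exists_euclidean_complex_of_homeomorph` — a space homeomorphic to the polyhedron of a finite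
  complex in ANY finite-dimensional real normed space `V` is homeomorphic to the polyhedron of a
  finite complex in `EuclideanSpace ℝ (Fin (dim V))` with the same face cardinalities;
* `buchner1977_cutLocus_triangulable_of_homeomorph_pi` — Buchner's fact follows from the bare
  triangulability of the metric cut locus by finite complexes in the carriers `Fin N → ℝ`
  (combine with `buchner1977_cutLocus_triangulable_of_homeomorph` of `CutLocusDimension.lean`,
  whose dimension clause is automatic).

No definitions, no named facts (D-0026); theorem-only file.

## References

* [Buchner1977Simplicial] M. A. Buchner, Proc. AMS 64 (1977), p. 118.
* [RourkeSanderson1972] C. P. Rourke, B. J. Sanderson, Introduction to piecewise-linear topology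
  (1972), Ch. 2 (images of complexes under simplicial embeddings), as used in
  `Literature/Analysis/Convexity/ComplexTransport.lean`.
-/

noncomputable section

open Set Function
open scoped Manifold ContDiff Topology

namespace Literature.Geometry.Riemannian

open Literature.Geometry.Lorentzian (PseudoRiemannianMetric)

/-! ### Transport of complexes along continuous linear equivalences -/

section Transport

variable {V W : Type*} [NormedAddCommGroup V] [NormedSpace ℝ V] [NormedAddCommGroup W]
  [NormedSpace ℝ W]

/-- **Transport of a geometric simplicial complex along a continuous linear equivalence.** For
`K` a simplicial complex in `V` and `e : V ≃L[ℝ] W` there is a complex `K'` in `W` whose faces are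
exactly the images `s.image e` of the faces of `K` and whose polyhedron is `e '' |K|`
(`Literature.Analysis.Convexity.exists_simplicialComplex_image` with the affine map `e`).
[folklore] -/
theorem exists_simplicialComplex_equiv_image [DecidableEq W] (K : Geometry.SimplicialComplex ℝ V)
    (e : V ≃L[ℝ] W) :
    ∃ K' : Geometry.SimplicialComplex ℝ W,
      (∀ t, t ∈ K'.faces ↔ ∃ s ∈ K.faces, s.image e = t) ∧ K'.space = e '' K.space := by
  obtain ⟨K', hfaces, hhull⟩ := Literature.Analysis.Convexity.exists_simplicialComplex_image K e
    (fun s _ => ⟨e.toLinearEquiv.toLinearMap.toAffineMap, fun x _ => rfl⟩) e.injective.injOn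
  refine ⟨K', hfaces, ?_⟩
  ext y
  simp only [Geometry.SimplicialComplex.mem_space_iff, mem_image]
  constructor
  · rintro ⟨t, ht, hy⟩
    obtain ⟨s, hs, rfl⟩ := (hfaces t).1 ht
    rw [hhull s hs] at hy
    obtain ⟨x, hx, rfl⟩ := hy
    exact ⟨x, ⟨s, hs, hx⟩, rfl⟩
  · rintro ⟨x, ⟨s, hs, hx⟩, rfl⟩
    refine ⟨s.image e, (hfaces _).2 ⟨s, hs, rfl⟩, ?_⟩
    rw [hhull s hs]
    exact ⟨x, hx, rfl⟩

/-- **The Euclidean carrier is immaterial.** If a topological space `X` is homeomorphic to the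
polyhedron of a finite simplicial complex `K` in a finite-dimensional real normed space `V`, then
it is homeomorphic to the polyhedron of a finite simplicial complex `K'` in
`EuclideanSpace ℝ (Fin (dim V))` whose faces have the cardinalities of faces of `K` (transport
along `ContinuousLinearEquiv.ofFinrankEq`). [folklore] -/
theorem exists_euclidean_complex_of_homeomorph [FiniteDimensional ℝ V]
    (K : Geometry.SimplicialComplex ℝ V) (hfin : K.faces.Finite) {X : Type*} [TopologicalSpace X]
    (f : X ≃ₜ K.space) :
    ∃ K' : Geometry.SimplicialComplex ℝ (EuclideanSpace ℝ (Fin (Module.finrank ℝ V))),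
      K'.faces.Finite ∧ (∀ t ∈ K'.faces, ∃ s ∈ K.faces, t.card = s.card) ∧
        Nonempty (X ≃ₜ K'.space) := by
  classical
  set e : V ≃L[ℝ] EuclideanSpace ℝ (Fin (Module.finrank ℝ V)) :=
    ContinuousLinearEquiv.ofFinrankEq finrank_euclideanSpace_fin.symm with he
  obtain ⟨K', hfaces, hspace⟩ := exists_simplicialComplex_equiv_image K e
  refine ⟨K', ?_, ?_, ?_⟩
  · have hK' : K'.faces = (fun s => s.image e) '' K.faces := by
      ext t
      rw [hfaces t]
      simp only [mem_image]
    rw [hK']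
    exact hfin.image _
  · intro t ht
    obtain ⟨s, hs, rfl⟩ := (hfaces t).1 ht
    exact ⟨s, hs, Finset.card_image_of_injective s e.injective⟩
  · have e1 : K.space ≃ₜ e '' K.space := e.toHomeomorph.image K.space
    have e2 : (e '' K.space) ≃ₜ K'.space := Homeomorph.setCongr hspace.symm
    exact ⟨f.trans (e1.trans e2)⟩

end Transport

/-! ### Buchner's fact from triangulability in the carriers `Fin N → ℝ` -/

section Reduction

universe u v w

/-- **Buchner's theorem follows from the triangulability of the cut locus by finite complexes in
`Fin N → ℝ`.** If on every compact connected Hausdorff boundaryless real-analytic Riemannian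
manifold the metric cut locus of every point is homeomorphic to the polyhedron of a finite
simplicial complex in some `Fin N → ℝ` (the carrier of the tree's triangulation theorems), then
`buchner1977_cutLocus_triangulable` holds: transport the complex to `EuclideanSpace ℝ (Fin N)`
(`exists_euclidean_complex_of_homeomorph`) and use
`buchner1977_cutLocus_triangulable_of_homeomorph` (the dimension clause is automatic,
`card_le_finrank_of_cutLocus_homeomorph`). The hypothesis — Buchner's subanalyticity of `C(p)`
(pp. 119–121) plus Hironaka's triangulation of compact subanalytic sets — is NOT vendored as a
fact (D-0026). [cite: Buchner1977Simplicial, pp. 118 and 121] -/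
theorem buchner1977_cutLocus_triangulable_of_homeomorph_pi
    (h : ∀ {E : Type u} [NormedAddCommGroup E] [NormedSpace ℝ E] [FiniteDimensional ℝ E]
      {H : Type v} [TopologicalSpace H] (I : ModelWithCorners ℝ E H) [I.Boundaryless]
      {M : Type w} [TopologicalSpace M] [ChartedSpace H M] [IsManifold I ω M]
      [CompactSpace M] [T2Space M] [ConnectedSpace M]
      (g : PseudoRiemannianMetric I ω E (TangentSpace I : M → Type _)) (hg : g.IsRiemannian)
      (p : M),
      ∃ (N : ℕ) (K : Geometry.SimplicialComplex ℝ (Fin N → ℝ)),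
        K.faces.Finite ∧ Nonempty (cutLocus g hg p ≃ₜ K.space)) :
    buchner1977_cutLocus_triangulable.{u, v, w} := by
  refine buchner1977_cutLocus_triangulable_of_homeomorph ?_
  intro E _ _ _ H _ I _ M _ _ _ _ _ _ g hg p
  obtain ⟨N, K, hfin, ⟨f⟩⟩ := h I g hg p
  obtain ⟨K', hfin', -, ⟨f'⟩⟩ := exists_euclidean_complex_of_homeomorph K hfin f
  refine ⟨Module.finrank ℝ (Fin N → ℝ), K', hfin', ⟨f'⟩⟩

end Reduction

end Literature.Geometry.Riemannian

end
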